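import Summits.BirchSwinnertonDyer.BirchSwinnertonDyer.Theorems.ManinLocalTwoThreeManinPrimeToThreeAtNineInhabited
import Literature.NumberTheory.EllipticCurves.WeightOneEtaQuotientsProofs
import Literature.NumberTheory.EllipticCurves.ModularSymbolsProofs
import Mathlib.Analysis.Complex.Liouville
import HarnessLib

/-!
# Cusp toolkit for the `η`-identities at level 27 (route `ManinLocalTwoThree`, cell bsd-f2-manin)

Analytic lemmas needed to verify Ligozat's identities `x³ = u² + 9u + 27`, `x′ = −2πi φ₂₇ (2u + 9)`
(`…AnalyticBridge.periodLatticeLeHex_of_etaIdentities`) by the cusp-form route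
"`S := (2πi)⁻¹x′ + φ₂₇(2u + 9) ∈ S₂(Γ₀(27)) = ℂφ₂₇` and `S/q → 0`, hence `S = 0`":

* `isZeroAtImInfty_deriv_of_isBoundedAtImInfty` — a holomorphic function on `ℍ` bounded at `i∞` has
  derivative `→ 0` at `i∞` (Cauchy's estimate on discs of radius `≍ Im τ`; no periodicity needed);
* `deriv_comp_smul_ofComplex` — the chain rule `(x ∘ γ)′(τ) = x′(γτ)·(cτ + d)⁻²` for `γ ∈ SL₂(ℤ)`;
* `isBoundedAtImInfty_etaQuotient_smul` — a weight-`0` `η`-quotient is BOUNDED at every cusp where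
  Ligozat's order `cuspOrder24` is `≥ 0` (from the tree's `isBoundedAtImInfty_etaQuotient_slash`);
* `cuspForm_twentySeven_eq_zero_of_tendsto` — a cusp form `S ∈ S₂(Γ₀(27))` with `S/q → 0` at `i∞`
  vanishes (`dim S₂(Γ₀(27)) = 1`, `φ₂₇/q → 1`).
-/

set_option autoImplicit false
set_option linter.dupNamespace false

noncomputable section

open Complex Filter Topology Set Function Asymptotics
open UpperHalfPlane hiding I
open scoped Real Topology Manifold MatrixGroups ModularForm
open ModularForm CongruenceSubgroup
open Literature.NumberTheory.EllipticCurves Literature.NumberTheory.EllipticCurves.ModularForms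

namespace Summit.BirchSwinnertonDyer.BirchSwinnertonDyer.Theorems.ManinLocalTwoThree.CuspToolkit

/-! ## 1. Cauchy: bounded at `i∞` ⟹ derivative `→ 0` at `i∞` -/

/-- **A holomorphic function on `ℍ` bounded at `i∞` has derivative tending to `0` at `i∞`**: by
Cauchy's estimate on the disc of radius `R = (Im τ − A₀)/2` around `τ`, `|g′(τ)| ≤ M/R → 0`.
[folklore] -/
theorem isZeroAtImInfty_deriv_of_isBoundedAtImInfty {g : ℍ → ℂ} (hg : MDifferentiable 𝓘(ℂ) 𝓘(ℂ) g)
    (hb : IsBoundedAtImInfty g) : IsZeroAtImInfty (fun τ : ℍ ↦ deriv (g ∘ ofComplex) τ) := by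
  obtain ⟨M, A, hM⟩ := isBoundedAtImInfty_iff.mp hb
  have hdiff : DifferentiableOn ℂ (g ∘ ofComplex) {z : ℂ | 0 < z.im} :=
    UpperHalfPlane.mdifferentiable_iff.mp hg
  rw [isZeroAtImInfty_iff]
  intro ε hε
  set M' : ℝ := max M 0 with hM'
  set A₀ : ℝ := max A 1 with hA₀
  have hM'0 : 0 ≤ M' := le_max_right _ _
  have hA₀1 : 1 ≤ A₀ := le_max_right _ _
  refine ⟨A₀ + 2 * (M' / ε) + 2, fun τ hτ ↦ ?_⟩
  set R : ℝ := (τ.im - A₀) / 2 with hR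
  have hRge : M' / ε + 1 ≤ R := by rw [hR]; linarith
  have hRpos : 0 < R := lt_of_lt_of_le (by positivity) hRge
  -- the closed disc of radius `R` about `τ` lies in `{Im ≥ A₀}`
  have hball : ∀ z ∈ Metric.closedBall (τ : ℂ) R, A₀ ≤ z.im := by
    intro z hz
    rw [Metric.mem_closedBall, dist_eq_norm] at hz
    have h1 : |(z - (τ : ℂ)).im| ≤ ‖z - (τ : ℂ)‖ := abs_im_le_norm _
    rw [sub_im, UpperHalfPlane.coe_im] at h1
    have h2 := (abs_le.mp (h1.trans hz)).1
    rw [hR] at h2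
    linarith
  have hsub : Metric.closedBall (τ : ℂ) R ⊆ {z : ℂ | 0 < z.im} :=
    fun z hz ↦ lt_of_lt_of_le (by linarith) (hball z hz)
  have hdc : DiffContOnCl ℂ (g ∘ ofComplex) (Metric.ball (τ : ℂ) R) := hdiff.diffContOnCl_ball hsub
  have hsphere : ∀ z ∈ Metric.sphere (τ : ℂ) R, ‖(g ∘ ofComplex) z‖ ≤ M' := by
    intro z hz
    have hzA : A₀ ≤ z.im := hball z (Metric.sphere_subset_closedBall hz)
    have hz0 : 0 < z.im := lt_of_lt_of_le (by linarith) hzA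
    have hA : A ≤ (ofComplex z).im := by
      rw [ofComplex_apply_of_im_pos hz0]
      exact (le_max_left _ _).trans hzA
    exact (hM _ hA).trans (le_max_left _ _)
  have hkey := Complex.norm_deriv_le_of_forall_mem_sphere_norm_le hRpos hdc hsphere
  refine hkey.trans ?_
  rw [div_le_iff₀ hRpos]
  have h1 : ε * (M' / ε + 1) ≤ ε * R := mul_le_mul_of_nonneg_left hRge hε.le
  have h2 : ε * (M' / ε + 1) = M' + ε := by field_simp
  linarith

/-! ## 2. The chain rule along a Möbius transformation -/

/-- `d/dτ [x(γτ)] = x′(γτ) · (cτ + d)⁻²` for `γ = (a b; c d) ∈ SL₂(ℤ)` and `x` holomorphic on `ℍ`.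
[folklore] -/
theorem deriv_comp_smul_ofComplex {x : ℍ → ℂ} (hx : MDifferentiable 𝓘(ℂ) 𝓘(ℂ) x) (g : SL(2, ℤ))
    (τ : ℍ) :
    deriv ((fun σ : ℍ ↦ x (g • σ)) ∘ ofComplex) τ
      = deriv (x ∘ ofComplex) ((g • τ : ℍ) : ℂ)
          * (1 / (((g 1 0 : ℤ) : ℂ) * (τ : ℂ) + ((g 1 1 : ℤ) : ℂ)) ^ 2) := by
  have hdiff := UpperHalfPlane.mdifferentiable_iff.mp hx
  have hτ : 0 < (τ : ℂ).im := τ.im_pos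
  have heq : ((fun σ : ℍ ↦ x (g • σ)) ∘ ofComplex) =ᶠ[𝓝 (τ : ℂ)] ((x ∘ ofComplex) ∘ moebius g) := by
    filter_upwards [isOpen_upperHalfPlaneSet.mem_nhds hτ] with z hz
    simp only [Function.comp_apply, smul_ofComplex g hz]
  rw [heq.deriv_eq]
  have hpt : ((g • τ : ℍ) : ℂ) = moebius g τ := by
    have := coe_smul_ofComplex g hτ
    rwa [ofComplex_apply] at this
  have h1 : HasDerivAt (x ∘ ofComplex) (deriv (x ∘ ofComplex) (moebius g τ)) (moebius g τ) :=
    ((hdiff _ (moebius_im_pos g hτ)).differentiableAt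
      (isOpen_upperHalfPlaneSet.mem_nhds (moebius_im_pos g hτ))).hasDerivAt
  rw [(h1.comp (τ : ℂ) (hasDerivAt_moebius g hτ)).deriv, hpt]

/-- `x ∘ γ` is holomorphic on `ℍ` for `x` holomorphic and `γ ∈ SL₂(ℤ)`. [folklore] -/
theorem mdifferentiable_comp_smul {x : ℍ → ℂ} (hx : MDifferentiable 𝓘(ℂ) 𝓘(ℂ) x) (g : SL(2, ℤ)) :
    MDifferentiable 𝓘(ℂ) 𝓘(ℂ) (fun σ : ℍ ↦ x (g • σ)) := by
  rw [UpperHalfPlane.mdifferentiable_iff]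
  have hdiff := UpperHalfPlane.mdifferentiable_iff.mp hx
  intro z hz
  have h1 : DifferentiableAt ℂ (x ∘ ofComplex) (moebius g z) :=
    (hdiff _ (moebius_im_pos g hz)).differentiableAt
      (isOpen_upperHalfPlaneSet.mem_nhds (moebius_im_pos g hz))
  have h2 : DifferentiableAt ℂ ((x ∘ ofComplex) ∘ moebius g) z :=
    h1.comp z (hasDerivAt_moebius g hz).differentiableAt
  refine (h2.congr_of_eventuallyEq ?_).differentiableWithinAt
  filter_upwards [isOpen_upperHalfPlaneSet.mem_nhds hz] with w hw
  simp only [Function.comp_apply, smul_ofComplex g hw]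

/-! ## 3. `η`-quotients of weight `0` are bounded at the cusps of non-negative Ligozat order

(The slash-`k` statement is the tree's `isBoundedAtImInfty_etaQuotient_slash`,
`WeightOneEtaQuotientsProofs`.) -/

/-- Weight-`0` form: if `Σ_δ r_δ = 0` and Ligozat's order at `c` is `≥ 0`, then `τ ↦ f(γτ)` is bounded
at `i∞`. [folklore] -/
theorem isBoundedAtImInfty_etaQuotient_smul (N : ℕ) (hN : 0 < N) (r : ℕ → ℤ)
    (hk : ∑ δ ∈ N.divisors, r δ = 0) (γ : SL(2, ℤ)) (hord : 0 ≤ cuspOrder24 N r (γ 1 0)) :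
    IsBoundedAtImInfty (fun τ : ℍ ↦ etaQuotient N r (γ • τ)) := by
  have h := isBoundedAtImInfty_etaQuotient_slash N hN r 0 (by rw [hk]; ring) γ hord
  refine h.congr_left fun τ ↦ ?_
  rw [← SL_slash, SL_slash_apply (f := etaQuotient N r), neg_zero, zpow_zero, mul_one]

/-! ## 4. A cusp form of weight `2` on `Γ₀(27)` with `S/q → 0` vanishes -/

/-- **`S ∈ S₂(Γ₀(27))` with `S(τ)/q → 0` at `i∞` is zero**: `S₂(Γ₀(27)) = ℂ·φ₂₇`
(`finrank_cuspForm_two_eq_genusX0_twentySeven`) and `φ₂₇/q → 1`, so `S = c φ₂₇` with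
`c = lim S/q = 0`. [folklore] -/
theorem cuspForm_twentySeven_eq_zero_of_tendsto (S : CuspForm (Gamma0 27) 2)
    (h : Tendsto (fun τ : ℍ ↦ S τ / Function.Periodic.qParam 1 (τ : ℂ)) atImInfty (𝓝 0)) :
    S = 0 := by
  obtain ⟨c, hc⟩ := finrank_cuspForm_two_eq_genusX0_twentySeven.2.2 S
  have hlim : Tendsto (fun τ : ℍ ↦ S τ / Function.Periodic.qParam 1 (τ : ℂ)) atImInfty (𝓝 c) := by
    have := (NonVacuityTwentySeven.tendsto_etaProductTwentySeven_div_qParam).const_mul c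
    rw [mul_one] at this
    refine this.congr fun τ ↦ ?_
    rw [← hc, CuspForm.IsGLPos.smul_apply, smul_eq_mul, mul_div_assoc]
  have hc0 : c = 0 := tendsto_nhds_unique hlim h
  rw [← hc, hc0, zero_smul]

end Summit.BirchSwinnertonDyer.BirchSwinnertonDyer.Theorems.ManinLocalTwoThree.CuspToolkit

end
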